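import Summits.SmoothPoincare4.SmoothPoincare4.Theorems.CongruenceShadowsHeegaardHandlebodyCongruenceClosedReduction
import Summits.SmoothPoincare4.SmoothPoincare4.Theorems.CongruenceShadowsHeegaardHandlebodyCongruenceClosedStubPairShadowFiniteQuotients
import Summits.SmoothPoincare4.SmoothPoincare4.Theorems.CongruenceShadowsHeegaardHandlebodyCongruenceClosedStubProfiniteFreenessDetection

/-!
# Crux `CongruenceShadows.HeegaardHandlebodyCongruenceClosed` is EQUIVALENT to "no fine ghosts" modulo three existing items
(item stmt-SmoothPoincare4-14596, line `pair-rigidity-retraction`; `--supports` the crux)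

Notation as in `…Reduction.lean`: `S = SurfaceGroup (3+3m)`, `N = s4Kernels.stabilizeIter m = (N₀,N₁,N₂)`,
`ρ ∈ Aut S` *product-congruent* = the crux hypothesis (`ρ ≡ x ∘ c` modulo every characteristic finite-index `M`,
`x ∈ Stab N₀ ∩ Stab N₁`, `c ∈ Stab N₂`), `T_ρ = (N₀, N₁, ρN₂)`, `J_ρ = N₀ ⊔ N₁ ⊔ ρN₂`, `G_ρ = S ⧸ J_ρ`.

The terminal shape of the line.  Write `HPFD` for the route item `HeegaardPairFreenessDetection`
(stmt-SmoothPoincare4-15157), `SA` for `ShadowApproximation` (stmt-14595), `WP` for `WaldhausenPairs` (stmt-14592), and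
`LSC` ("limits simply connected" = no fine ghosts) for `∀ m ρ, product-congruent ρ → J_ρ = ⊤`.

* `hhcc_iff_limitsSimplyConnected_of_items : HPFD → SA → WP → (HeegaardHandlebodyCongruenceClosed ↔ LSC)`.
  So, modulo three EXISTING items of the route, the crux IS the private ghost-exclusion statement `LSC`
  (its genus-3 instance is the theorem `limitsSimplyConnected_zero`; genera `≥ 6` are open).  The direction `→` is
  unconditional (`limitsSimplyConnected_of_hhcc`).
* `hhccOnLocus_of_items : HPFD → SA → WP → ∀ m ρ, product-congruent ρ → J_ρ = ⊤ → ρ ∈ (Stab N₀ ∩ Stab N₁)·Stab N₂`: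
  the crux RESTRICTED TO THE GATE LOCUS `G_ρ = 1` — the only form the route's `ArtinGates` applies — holds modulo the
  same three items, with no private residue.
* `hhcc_of_items_of_limitsSimplyConnectedPos`: the crux from the three items and `LSC` at genera `≥ 6` only.
* `stub_hhccOfItemsOfLimitsSimplyConnectedPos`, `stub_hhccIffLimitsSimplyConnectedOfItems`: the two registered TRANSFER
  stubs of the lead's skeleton v2 (`Cruxes/HeegaardHandlebodyCongruenceClosed/Lines/pair_rigidity_retraction.lean`),
  signatures verbatim.
-/

noncomputable section

-- the prescribed namespace `Summit.<P>.<Sub>.…` duplicates `SmoothPoincare4` (P = Sub)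
set_option linter.dupNamespace false

namespace Summit.SmoothPoincare4.SmoothPoincare4.Theorems.HeegaardHandlebodyCongruenceClosed.PairRigidityRetraction

open Literature.Topology.FourManifolds Subgroup
open Summit.SmoothPoincare4.SmoothPoincare4.Theses.CongruenceShadows
  (HeegaardHandlebodyCongruenceClosed ShadowApproximation WaldhausenPairs HeegaardPairFreenessDetection)

/-! ## The locus form of the crux, closed modulo the three items -/

/-- **The crux on the gate locus, from three existing items.**  Assume `HeegaardPairFreenessDetection`
(stmt-15157), `ShadowApproximation` (stmt-14595) and `WaldhausenPairs` (stmt-14592).  Then every product-congruent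
`ρ ∈ Aut S_{3+3m}` whose glued group is trivial (`N₀ ⊔ N₁ ⊔ ρN₂ = ⊤`) is a product `x ∘ c` with
`x ∈ Stab N₀ ∩ Stab N₁`, `c ∈ Stab N₂`.  Proof: the two twisted pairs `(N_i, ρN₂)` are shadow-standard (witness `x_M`),
hence have the finite quotients of `F_{m+1}` (P1, `stub_pairShadowFiniteQuotients`), hence are free of rank `m+1`
(stmt-15157 via `stub_profiniteFreenessDetection_of_fact`); with `J_ρ = ⊤`, `T_ρ` is a group trisection of `{1}`
(`isGroupTrisection_twisted_of_free`), so `Iso N T_ρ` (`fineApprox_of_items`) and `ρ ∈ (A∩B)·C` (`isProduct_of_iso`).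
[folklore] -/
theorem hhccOnLocus_of_items (hF : HeegaardPairFreenessDetection) (hSA : ShadowApproximation)
    (hW : WaldhausenPairs) (m : ℕ) (ρ : SurfaceGroup (3 + 3 * m) ≃* SurfaceGroup (3 + 3 * m))
    (hρ : ∀ M : Subgroup (SurfaceGroup (3 + 3 * m)), M.Characteristic → M.FiniteIndex →
      ∃ x c : SurfaceGroup (3 + 3 * m) ≃* SurfaceGroup (3 + 3 * m),
        (s4Kernels.stabilizeIter m 0).map x.toMonoidHom = s4Kernels.stabilizeIter m 0 ∧
        (s4Kernels.stabilizeIter m 1).map x.toMonoidHom = s4Kernels.stabilizeIter m 1 ∧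
        (s4Kernels.stabilizeIter m 2).map c.toMonoidHom = s4Kernels.stabilizeIter m 2 ∧
        ∀ s, ρ s * (x (c s))⁻¹ ∈ M)
    (htop : s4Kernels.stabilizeIter m 0 ⊔ s4Kernels.stabilizeIter m 1 ⊔
      (s4Kernels.stabilizeIter m 2).map ρ.toMonoidHom = ⊤) :
    ∃ x c : SurfaceGroup (3 + 3 * m) ≃* SurfaceGroup (3 + 3 * m),
      (s4Kernels.stabilizeIter m 0).map x.toMonoidHom = s4Kernels.stabilizeIter m 0 ∧
      (s4Kernels.stabilizeIter m 1).map x.toMonoidHom = s4Kernels.stabilizeIter m 1 ∧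
      (s4Kernels.stabilizeIter m 2).map c.toMonoidHom = s4Kernels.stabilizeIter m 2 ∧ ∀ s, ρ s = x (c s) := by
  -- shadow-standardness of the two pairs `(N_i, ρN₂)`, `i = 0, 1` (witness `x_M`)
  have hshadow : ∀ i : Fin 3, i ≠ 2 → ∀ M : Subgroup (SurfaceGroup (3 + 3 * m)), M.Characteristic → M.FiniteIndex →
      ∃ a : SurfaceGroup (3 + 3 * m) ≃* SurfaceGroup (3 + 3 * m),
        (s4Kernels.stabilizeIter m i ⊔ M).map a.toMonoidHom = s4Kernels.stabilizeIter m i ⊔ M ∧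
        (s4Kernels.stabilizeIter m 2 ⊔ M).map a.toMonoidHom = (s4Kernels.stabilizeIter m 2).map ρ.toMonoidHom ⊔ M := by
    intro i hi M hM hFi
    obtain ⟨x, c, hx0, hx1, hc, hs⟩ := hρ M hM hFi
    have hNi : (s4Kernels.stabilizeIter m i).map x.toMonoidHom = s4Kernels.stabilizeIter m i := by
      fin_cases i
      · exact hx0
      · exact hx1
      · exact absurd rfl hi
    refine ⟨x, ?_, ?_⟩
    · rw [Subgroup.map_sup, map_eq_of_characteristic x hM, hNi]
    · rw [Subgroup.map_sup, map_eq_of_characteristic x hM, map_sup_eq_of_congr hs (s4Kernels.stabilizeIter m 2), hc]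
  have hfree : ∀ i : Fin 3, i ≠ 2 → IsFreeOfRank (SurfaceGroup (3 + 3 * m) ⧸ normalClosure
      ((s4Kernels.stabilizeIter m i : Set (SurfaceGroup (3 + 3 * m))) ∪
        ((s4Kernels.stabilizeIter m 2).map ρ.toMonoidHom : Subgroup (SurfaceGroup (3 + 3 * m))))) (m + 1) :=
    fun i hi => stub_profiniteFreenessDetection_of_fact hF m i hi ρ
      (stub_pairShadowFiniteQuotients m i hi ρ (hshadow i hi))
  exact isProduct_of_iso (fineApprox_of_items hSA hW m ρ hρ
    (isGroupTrisection_twisted_of_free (hfree 0 (by decide)) (hfree 1 (by decide)) htop))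

/-! ## The crux from the three items and "no fine ghosts" at genera `≥ 6` -/

/-- **The crux from three existing items and P3.**  `HeegaardPairFreenessDetection` (stmt-15157),
`ShadowApproximation` (stmt-14595), `WaldhausenPairs` (stmt-14592) and "limits simply connected" at genera
`3+3(m+1)` (the registered open stub P3 `stub_limitsSimplyConnected` of the line, verbatim) imply
`HeegaardHandlebodyCongruenceClosed` (genus 3 is `limitsSimplyConnected_zero`).  `= hhcc_of_parts` with P1 proved and
P2 instantiated from stmt-15157. [folklore] -/
theorem hhcc_of_items_of_limitsSimplyConnectedPos (hF : HeegaardPairFreenessDetection) (hSA : ShadowApproximation)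
    (hW : WaldhausenPairs)
    (hP3 : ∀ (m : ℕ) (ρ : SurfaceGroup (3 + 3 * (m + 1)) ≃* SurfaceGroup (3 + 3 * (m + 1))),
      (∀ M : Subgroup (SurfaceGroup (3 + 3 * (m + 1))), M.Characteristic → M.FiniteIndex →
        ∃ x c : SurfaceGroup (3 + 3 * (m + 1)) ≃* SurfaceGroup (3 + 3 * (m + 1)),
          (s4Kernels.stabilizeIter (m + 1) 0).map x.toMonoidHom = s4Kernels.stabilizeIter (m + 1) 0 ∧
          (s4Kernels.stabilizeIter (m + 1) 1).map x.toMonoidHom = s4Kernels.stabilizeIter (m + 1) 1 ∧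
          (s4Kernels.stabilizeIter (m + 1) 2).map c.toMonoidHom = s4Kernels.stabilizeIter (m + 1) 2 ∧
          ∀ s, ρ s * (x (c s))⁻¹ ∈ M) →
      s4Kernels.stabilizeIter (m + 1) 0 ⊔ s4Kernels.stabilizeIter (m + 1) 1 ⊔
        (s4Kernels.stabilizeIter (m + 1) 2).map ρ.toMonoidHom = ⊤) :
    HeegaardHandlebodyCongruenceClosed :=
  hhcc_of_parts stub_pairShadowFiniteQuotients (stub_profiniteFreenessDetection_of_fact hF) hP3 hSA hW

/-! ## The equivalence -/

/-- **Modulo three existing items, the crux IS "no fine ghosts".**  Assume `HeegaardPairFreenessDetection`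
(stmt-15157), `ShadowApproximation` (stmt-14595) and `WaldhausenPairs` (stmt-14592).  Then
`HeegaardHandlebodyCongruenceClosed` holds iff every product-congruent `ρ`, at every genus `3+3m`, glues a simply
connected 4-manifold: `N₀ ⊔ N₁ ⊔ ρN₂ = ⊤`.  (`→`: `limitsSimplyConnected_of_hhcc`, unconditionally; `←`: on the locus
`N₀ ⊔ N₁ ⊔ ρN₂ = ⊤` the crux is `hhccOnLocus_of_items`.)  A counterexample to the right-hand side is a "fine ghost": a
balanced group trisection, lying in the fine congruence closure of the product set, of an INFINITE group with no
non-trivial finite quotient (`stub_limitsSimplyConnectedDichotomy`). [folklore] -/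
theorem hhcc_iff_limitsSimplyConnected_of_items (hF : HeegaardPairFreenessDetection) (hSA : ShadowApproximation)
    (hW : WaldhausenPairs) :
    HeegaardHandlebodyCongruenceClosed ↔
      ∀ (m : ℕ) (ρ : SurfaceGroup (3 + 3 * m) ≃* SurfaceGroup (3 + 3 * m)),
        (∀ M : Subgroup (SurfaceGroup (3 + 3 * m)), M.Characteristic → M.FiniteIndex →
          ∃ x c : SurfaceGroup (3 + 3 * m) ≃* SurfaceGroup (3 + 3 * m),
            (s4Kernels.stabilizeIter m 0).map x.toMonoidHom = s4Kernels.stabilizeIter m 0 ∧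
            (s4Kernels.stabilizeIter m 1).map x.toMonoidHom = s4Kernels.stabilizeIter m 1 ∧
            (s4Kernels.stabilizeIter m 2).map c.toMonoidHom = s4Kernels.stabilizeIter m 2 ∧
            ∀ s, ρ s * (x (c s))⁻¹ ∈ M) →
        s4Kernels.stabilizeIter m 0 ⊔ s4Kernels.stabilizeIter m 1 ⊔
          (s4Kernels.stabilizeIter m 2).map ρ.toMonoidHom = ⊤ :=
  ⟨fun hC m ρ hρ => limitsSimplyConnected_of_hhcc hC m ρ hρ,
    fun hL m ρ hρ => hhccOnLocus_of_items hF hSA hW m ρ hρ (hL m ρ hρ)⟩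

/-! ## Registered stubs of skeleton v2 (signatures verbatim as registered on stmt-SmoothPoincare4-14596) -/

/-- **Registered TRANSFER stub `stub_hhccOfItemsOfLimitsSimplyConnectedPos` of line `pair-rigidity-retraction`
(skeleton v2):** the crux statement (unfolded) from the three existing items 15157, 14595, 14592 and P3 at genera
`≥ 6`; `= hhcc_of_items_of_limitsSimplyConnectedPos`. [folklore] -/
theorem stub_hhccOfItemsOfLimitsSimplyConnectedPos :
    HeegaardPairFreenessDetection → ShadowApproximation → WaldhausenPairs →
      (∀ (m : ℕ) (ρ : SurfaceGroup (3 + 3 * (m + 1)) ≃* SurfaceGroup (3 + 3 * (m + 1))),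
        (∀ M : Subgroup (SurfaceGroup (3 + 3 * (m + 1))), M.Characteristic → M.FiniteIndex →
          ∃ x c : SurfaceGroup (3 + 3 * (m + 1)) ≃* SurfaceGroup (3 + 3 * (m + 1)),
            (s4Kernels.stabilizeIter (m + 1) 0).map x.toMonoidHom = s4Kernels.stabilizeIter (m + 1) 0 ∧
            (s4Kernels.stabilizeIter (m + 1) 1).map x.toMonoidHom = s4Kernels.stabilizeIter (m + 1) 1 ∧
            (s4Kernels.stabilizeIter (m + 1) 2).map c.toMonoidHom = s4Kernels.stabilizeIter (m + 1) 2 ∧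
            ∀ s, ρ s * (x (c s))⁻¹ ∈ M) →
        s4Kernels.stabilizeIter (m + 1) 0 ⊔ s4Kernels.stabilizeIter (m + 1) 1 ⊔
          (s4Kernels.stabilizeIter (m + 1) 2).map ρ.toMonoidHom = ⊤) →
      ∀ (m : ℕ) (ρ : SurfaceGroup (3 + 3 * m) ≃* SurfaceGroup (3 + 3 * m)),
        (∀ M : Subgroup (SurfaceGroup (3 + 3 * m)), M.Characteristic → M.FiniteIndex →
          ∃ x c : SurfaceGroup (3 + 3 * m) ≃* SurfaceGroup (3 + 3 * m),
            (s4Kernels.stabilizeIter m 0).map x.toMonoidHom = s4Kernels.stabilizeIter m 0 ∧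
            (s4Kernels.stabilizeIter m 1).map x.toMonoidHom = s4Kernels.stabilizeIter m 1 ∧
            (s4Kernels.stabilizeIter m 2).map c.toMonoidHom = s4Kernels.stabilizeIter m 2 ∧
            ∀ s, ρ s * (x (c s))⁻¹ ∈ M) →
        ∃ x c : SurfaceGroup (3 + 3 * m) ≃* SurfaceGroup (3 + 3 * m),
          (s4Kernels.stabilizeIter m 0).map x.toMonoidHom = s4Kernels.stabilizeIter m 0 ∧
          (s4Kernels.stabilizeIter m 1).map x.toMonoidHom = s4Kernels.stabilizeIter m 1 ∧
          (s4Kernels.stabilizeIter m 2).map c.toMonoidHom = s4Kernels.stabilizeIter m 2 ∧ ∀ s, ρ s = x (c s) :=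
  fun hF hSA hW hP3 => hhcc_of_items_of_limitsSimplyConnectedPos hF hSA hW hP3

/-- **Registered TRANSFER stub `stub_hhccIffLimitsSimplyConnectedOfItems` of line `pair-rigidity-retraction`
(skeleton v2):** modulo the three existing items 15157, 14595, 14592 the crux IS "limits simply connected" at all
genera; `= hhcc_iff_limitsSimplyConnected_of_items`. [folklore] -/
theorem stub_hhccIffLimitsSimplyConnectedOfItems :
    HeegaardPairFreenessDetection → ShadowApproximation → WaldhausenPairs →
      (HeegaardHandlebodyCongruenceClosed ↔
        ∀ (m : ℕ) (ρ : SurfaceGroup (3 + 3 * m) ≃* SurfaceGroup (3 + 3 * m)),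
          (∀ M : Subgroup (SurfaceGroup (3 + 3 * m)), M.Characteristic → M.FiniteIndex →
            ∃ x c : SurfaceGroup (3 + 3 * m) ≃* SurfaceGroup (3 + 3 * m),
              (s4Kernels.stabilizeIter m 0).map x.toMonoidHom = s4Kernels.stabilizeIter m 0 ∧
              (s4Kernels.stabilizeIter m 1).map x.toMonoidHom = s4Kernels.stabilizeIter m 1 ∧
              (s4Kernels.stabilizeIter m 2).map c.toMonoidHom = s4Kernels.stabilizeIter m 2 ∧
              ∀ s, ρ s * (x (c s))⁻¹ ∈ M) →
          s4Kernels.stabilizeIter m 0 ⊔ s4Kernels.stabilizeIter m 1 ⊔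
            (s4Kernels.stabilizeIter m 2).map ρ.toMonoidHom = ⊤) :=
  fun hF hSA hW => hhcc_iff_limitsSimplyConnected_of_items hF hSA hW

end Summit.SmoothPoincare4.SmoothPoincare4.Theorems.HeegaardHandlebodyCongruenceClosed.PairRigidityRetraction

end
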